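/-
Copyright (c) 2026 the pub-hodgecm-mathlib formalisation cell (harness21).  Prover seat hodgecm-mathlib-K2E1-p02 (g0), Track B ∕ K2-LIT
(build stream 29), h413 = `stmt-HodgeConjecture-24833`, line `K2_E1_TraceFormulaBeta`, socket module «GlobalIndex» §1, file #2 — the payment of
`K2E1TraceFormulaBeta.GlobalIndex.sig_K2E1OccursCountable` TOKEN FOR TOKEN.  2026-09-03.
-/
import Summits.HodgeConjecture.HodgeConjecture.Theorems.F0P3GlobalPacketDiscrete   -- ★ `OccursInDiscreteSpectrum`, ★ `cmOccursInDiscreteSpectrum` (+ the frame)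
import Mathlib.Analysis.InnerProductSpace.Projection.Basic                      -- `Submodule.starProjection`
import Mathlib.MeasureTheory.Measure.SeparableMeasure                           -- `MeasureTheory.Lp.SecondCountableTopology`
import Mathlib.Topology.LocallyConstant.Basic                                     -- `IsLocallyConstant.range_finite`
import HarnessLib

/-!
# h413 ∕ Track B «K2-LIT», line `K2_E1_TraceFormulaBeta`, socket module «GlobalIndex» §1: THE OCCURRING FAMILIES OF LOCAL CLASSES ARE COUNTABLE
# (payment of `Cruxes/H413/Lines/K2_E1_TraceFormulaBetaSigs_GlobalIndex.lean :: sig_K2E1OccursCountable`, statement bytes frozen)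

Cell `pub/hodgecm-mathlib`, crux H413 = `stmt-HodgeConjecture-24833`, route of record `HCCMUnconditional`; chair K2-lead (g0), dealer K2E1-plan (g0),
EMIT «SKELETON LANDED K2E1» (REQUESTS l.72374) file #2 `sig_K2E1OccursCountable` (M, first rung) ↦ seat K2E1-p02.  THEOREMS ONLY (no `def`, no `instance`,
no `notation`, no named-fact hypothesis, no `sorry`); imports = ★ `Theorems.F0P3GlobalPacketDiscrete` + Mathlib + HarnessLib; lane `--supports stmt-HodgeConjecture-24833`
(kit law COUNTABLE of the tier-0 socket `stub_E1_St1383`; it does not move 24833 by itself).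

THE STATEMENT (bytes of the socket; the Lines-side `abbrev Pl L := HeightOneSpectrum (𝓞 L⁺)` inlined).  For every CM field `L`, every `N`, EVERY `H ∈ M_N(L)` and every
automorphic measure `μ` on `U(H)(L⁺)\U(H)(𝔸_{L⁺})`, the set of families `π = (π_u)_u` of classes of irreducible smooth representations of the `U(H)(L⁺_u)` that OCCUR IN
THE DISCRETE SPECTRUM (★ `cmOccursInDiscreteSpectrum`: some discrete automorphic `P ≤ L²` has an irreducible smooth admissible finite component `σ ↪ P|_{U(H)(𝔸_f)}`
whose constituents at every finite place are exactly `{π_u}`) is COUNTABLE — the frame «`X` a countable set of irreducible unitary representations» of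
[Rogawski1990, Prop. 13.8.1 p. 213] for the discrete spectrum of a unitary group [BorelJacquet1979, §4.6].

THE PROOF (strategy: ORTHOGONALITY OF NON-ISOMORPHIC ADMISSIBLE FINITE COMPONENTS INSIDE THE UNITARY `L²`, then SEPARABILITY — no tensor-product theorem, no
multiplicity statement, no decomposition of `L²_disc` is used or proved).
* §1 In a separable inner-product space a family of pairwise orthogonal non-zero vectors has countable index: normalise, approximate each vector within `1/2` by a
  member of a countable dense set; distinct orthonormal vectors are at distance `√2 > 1`, so the approximation is injective [Dixmier1977, §5.4].
* §2 For a unitary `R : G → U(V)`, a compact subgroup `K` and a vector `y` with OPEN stabiliser, the `K`-orbit of `y` is FINITE (locally constant on the compact `K`)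
  and its average `a = |K·y|⁻¹ Σ_{z ∈ K·y} z` is a `K`-fixed vector in the span of the orbit with `⟪u, a⟫ = ⟪u, y⟫` for every `K`-fixed `u` — `a` is the orthogonal
  projection of `y` onto the closed space `V^K` of `K`-fixed vectors [BushnellHenniart2006, §2.1–2.2; BernsteinZelevinsky1976, §2.1].
* §3 For an ADMISSIBLE `σ′` embedded by an injective intertwiner `f′ : σ′ → R`, the `K`-fixed vectors (`K` compact open) of the CLOSURE of `f′(σ′)` already lie in
  `f′(σ′)`: the projection onto `V^K` maps `f′(σ′)` into the finite-dimensional — hence closed — image `f′(σ′^K)` (§2), so it maps the closure there too.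
* §4 SCHUR ACROSS THE CLOSURE: for `σ` irreducible smooth and `σ′` irreducible admissible, both mapped equivariantly into the unitary `R` (`f`, and `f′` injective),
  the orthogonal projection `Q` onto the closure of `f′(σ′)` commutes with `R` (the closure and its orthogonal complement are invariant, `R` being unitary), sends each
  smooth vector `f w` to a vector fixed by a compact open subgroup, hence (§3) into `f′(σ′)`; so `f′⁻¹ ∘ Q ∘ f : σ → σ′` is an intertwiner, which is `0` or an
  isomorphism (Mathlib `Representation.IsIrreducible.bijective_or_eq_zero`).  If `σ ≇ σ′` it is `0`: `f(σ) ⟂ f′(σ′)`.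
* §5 (generic frame `F ⊆ E`, `c`, `J` of ★ `OccursInDiscreteSpectrum`) Two occurring families with ISOMORPHIC witnessing finite components coincide (constituents pass
  along equivalences and along the place inclusions, ★ `IrrClass.IsConstituentOf.of_injective_comp`); so distinct occurring families have non-isomorphic irreducible
  admissible finite components embedded (through their discrete `P ≤ L²`) in the finite-adelic restriction of the unitary regular representation on
  `L²(U(J)(F)\U(J)(𝔸_F), μ)` (★ `isUnitary_rightRegular`), hence ORTHOGONAL non-zero vectors (§4, compact open subgroup ★ `finAdelicIntegralLevel`); and `L²` is separable
  (the automorphic quotient is a second-countable Borel space and `μ` is finite: Mathlib `MeasureTheory.Lp.SecondCountableTopology`), so §1 applies.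
* §6 **`OccursCountable`** · `sig_K2E1OccursCountable` TOKEN FOR TOKEN: the CM currency is the generic one transported along ★ `localPiEquiv` (an injection on families,
  ★ `IrrClass.comap_symm_comap`).  Tie probe at home once the socket module is built on stream 29:
  `example : type_of% @OccursCountable = type_of% @K2E1TraceFormulaBeta.GlobalIndex.sig_K2E1OccursCountable := rfl` (`K2/K2E1-p02/g0/Probe_K2E1OccursCountable.lean`).

WHAT IS NOT HERE.  Finite multiplicities (file `sig_K2E1FiniteMultiplicitiesUnitary`); the uniqueness of the finite component of a given `P` (★ «AFU» — not needed: the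
argument never compares two finite components of the SAME `P`); any decomposition `L²_disc = ⊕̂ m(π) π`.
HONEST LABEL.  HC_CM is proved only modulo the 7 printed citations (2 remaining named inputs: hLiu418 = `stmt-HodgeConjecture-24832`, h413 =
`stmt-HodgeConjecture-24833`) until rung 0 closes; this file pays one socket of the K2E1 skeleton and proves no printed letter by itself.
References: [BorelJacquet1979] §4.6; [Rogawski1990] §13.1 p. 199, §13.3 p. 201, §13.8 Prop. 13.8.1 p. 213; [Dixmier1977] §5.4; [BushnellHenniart2006] §1.1, §2.1–2.2, §2.6;
[BernsteinZelevinsky1976] §2.1, §2.11.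
-/

set_option autoImplicit false
-- the mandated namespace repeats `HodgeConjecture.HodgeConjecture`, as in every `Theorems/*.lean` of this sub-problem
set_option linter.dupNamespace false

noncomputable section

open NumberField IsDedekindDomain MeasureTheory
open scoped InnerProductSpace

namespace Summit.HodgeConjecture.HodgeConjecture.Cruxes.H413.K2E1OccursCountable

open Literature.NumberTheory.Automorphic Literature.NumberTheory.Automorphic.UnitaryGroup
open Summit.HodgeConjecture.HodgeConjecture.Cruxes.H413.F0P3GlobalPacketDiscrete (OccursInDiscreteSpectrum cmOccursInDiscreteSpectrum)

/-! ## §1 Pairwise orthogonal non-zero vectors of a separable inner-product space have a countable index -/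

/-- **A pairwise-orthogonal family of non-zero vectors in a SEPARABLE complex inner-product space has countable index**: after normalisation the
vectors are pairwise at distance `√2 ≥ 1`, and approximating each within `1/2` by an element of a countable dense subset is injective.
[cite: Dixmier1977, §5.4] -/
theorem countable_of_pairwise_inner_eq_zero {V : Type*} [NormedAddCommGroup V] [InnerProductSpace ℂ V]
    [TopologicalSpace.SeparableSpace V] {ι : Type*} (u : ι → V) (h0 : ∀ i, u i ≠ 0)
    (horth : Pairwise fun i j => ⟪u i, u j⟫_ℂ = 0) : Countable ι := by
  classical
  obtain ⟨D, hDc, hDd⟩ := TopologicalSpace.exists_countable_dense V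
  set v : ι → V := fun i => ((‖u i‖ : ℂ)⁻¹) • u i with hv
  have hv1 : ∀ i, ‖v i‖ = 1 := fun i => norm_smul_inv_norm (h0 i)
  have hvorth : Pairwise fun i j => ⟪v i, v j⟫_ℂ = 0 := fun i j hij => by
    simp only [hv, inner_smul_left, inner_smul_right, horth hij, mul_zero]
  have hdist : Pairwise fun i j => (1 : ℝ) ≤ dist (v i) (v j) := fun i j hij => by
    have h2 : ‖v i - v j‖ ^ 2 = 2 := by
      rw [@norm_sub_sq ℂ, hvorth hij, map_zero, mul_zero, sub_zero, hv1 i, hv1 j]; norm_num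
    show (1 : ℝ) ≤ dist (v i) (v j)
    rw [dist_eq_norm]; nlinarith [norm_nonneg (v i - v j), h2]
  have hD : ∀ i, ∃ d ∈ D, dist (v i) d < 1 / 2 := fun i => hDd.exists_dist_lt (v i) (by norm_num)
  choose d hdD hd using hD
  have hinj : Function.Injective d := fun i j hij => by
    by_contra hne
    have hi : dist (v i) (d j) < 1 / 2 := hij ▸ hd i
    have hlt : dist (v i) (v j) < 1 :=
      calc dist (v i) (v j) ≤ dist (v i) (d j) + dist (v j) (d j) := dist_triangle_right _ _ _
        _ < 1 / 2 + 1 / 2 := add_lt_add hi (hd j)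
        _ = 1 := by norm_num
    exact absurd (hdist hne) (not_le.2 hlt)
  haveI : Countable D := hDc.to_subtype
  exact Function.Injective.countable (f := fun i => (⟨d i, hdD i⟩ : D)) fun i j h => hinj (Subtype.ext_iff.1 h)

/-! ## §2 Averaging a smooth vector over a compact subgroup inside a unitary representation -/

section Unitary

variable {G : Type*} [Group G] [TopologicalSpace G] [IsTopologicalGroup G]
  {V : Type*} [NormedAddCommGroup V] [InnerProductSpace ℂ V] [CompleteSpace V]

/-- **Finite `K`-average of a smooth vector.**  For a unitary representation `R` of `G` on a Hilbert space, a compact subgroup `K` and a vector `y` whose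
stabiliser is open, the `K`-orbit of `y` is finite and its average `a` lies in the span of the orbit, is `K`-fixed, and satisfies `⟪u, a⟫ = ⟪u, y⟫` for every
`K`-fixed `u` (so `a` is the orthogonal projection of `y` onto the `K`-fixed vectors). [cite: BushnellHenniart2006, §2.1–2.2] [cite: BernsteinZelevinsky1976, §2.1] -/
theorem exists_average (R : ContRepresentation ℂ G V) (hR : R.IsUnitary) {K : Subgroup G}
    (hK : IsCompact (K : Set G)) {y : V} (hy : IsOpen (R.toRepresentation.stabilizerSubgroup y : Set G)) :
    ∃ a ∈ Submodule.span ℂ (Set.range fun k : K => R (k : G) y),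
      (∀ k ∈ K, R k a = a) ∧ ∀ u : V, (∀ k ∈ K, R k u = u) → ⟪u, a⟫_ℂ = ⟪u, y⟫_ℂ := by
  classical
  haveI : CompactSpace K := isCompact_iff_compactSpace.mp hK
  have hloc : IsLocallyConstant fun k : K => R (k : G) y := by
    refine (IsLocallyConstant.iff_eventually_eq _).2 fun k₀ => ?_
    have hcont : Continuous fun k : K => (k₀ : G)⁻¹ * (k : G) := continuous_const.mul continuous_subtype_val
    have hmem : k₀ ∈ {k : K | (k₀ : G)⁻¹ * (k : G) ∈ R.toRepresentation.stabilizerSubgroup y} := by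
      simp only [Set.mem_setOf_eq, inv_mul_cancel, Subgroup.one_mem]
    filter_upwards [(hy.preimage hcont).mem_nhds hmem] with k hk
    have hk' : R ((k₀ : G)⁻¹ * (k : G)) y = y := hk
    calc R (k : G) y = R ((k₀ : G) * ((k₀ : G)⁻¹ * (k : G))) y := by rw [mul_inv_cancel_left]
      _ = R (k₀ : G) (R ((k₀ : G)⁻¹ * (k : G)) y) := by rw [map_mul, mul_apply_eq_comp]
      _ = R (k₀ : G) y := by rw [hk']
  obtain ⟨s, hs⟩ : ∃ s : Finset V, ∀ z, z ∈ s ↔ ∃ k : K, R (k : G) y = z :=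
    ⟨hloc.range_finite.toFinset, fun z => by simp only [Set.Finite.mem_toFinset, Set.mem_range]⟩
  have hy_mem : y ∈ s := (hs y).2 ⟨1, by simp only [OneMemClass.coe_one, map_one, one_apply_eq_self]⟩
  have hcard : (s.card : ℂ) ≠ 0 := Nat.cast_ne_zero.2 (Finset.card_pos.2 ⟨y, hy_mem⟩).ne'
  have hperm : ∀ k ∈ K, ∀ z ∈ s, R k z ∈ s := fun k hk z hz => by
    obtain ⟨k', rfl⟩ := (hs z).1 hz
    exact (hs _).2 ⟨⟨k * k', K.mul_mem hk k'.2⟩, by simp only [map_mul, mul_apply_eq_comp]⟩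
  have hinner : ∀ u : V, (∀ k ∈ K, R k u = u) → ∀ z ∈ s, ⟪u, z⟫_ℂ = ⟪u, y⟫_ℂ := fun u hu z hz => by
    obtain ⟨k, rfl⟩ := (hs z).1 hz
    rw [← ContinuousLinearMap.adjoint_inner_left, hR.adjoint_apply, hu _ (K.inv_mem k.2)]
  refine ⟨(s.card : ℂ)⁻¹ • ∑ z ∈ s, z, ?_, ?_, ?_⟩
  · exact Submodule.smul_mem _ _ (Submodule.sum_mem _ fun z hz => by
      obtain ⟨k, rfl⟩ := (hs z).1 hz
      exact Submodule.subset_span ⟨k, rfl⟩)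
  · intro k hk
    rw [ContinuousLinearMap.map_smul, map_sum]
    congr 1
    exact Finset.sum_nbij' (fun z => R k z) (fun z => R k⁻¹ z) (hperm k hk) (hperm k⁻¹ (K.inv_mem hk))
      (fun z _ => by rw [← mul_apply_eq_comp, ← map_mul, inv_mul_cancel, map_one, one_apply_eq_self])
      (fun z _ => by rw [← mul_apply_eq_comp, ← map_mul, mul_inv_cancel, map_one, one_apply_eq_self])
      (fun z _ => rfl)
  · intro u hu
    rw [inner_smul_right, inner_sum, Finset.sum_congr rfl (hinner u hu), Finset.sum_const, nsmul_eq_mul, ← mul_assoc,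
      inv_mul_cancel₀ hcard, one_mul]

/-! ## §3 Fixed vectors of the closure of an embedded admissible representation -/

/-- **The `K`-fixed vectors of the closure of an embedded ADMISSIBLE representation are already in it.**  Let `σ′` be admissible, `f′ : σ′ → R` an injective
intertwiner into the unitary `R`, `K` a compact open subgroup.  A vector of the closure of `f′(σ′)` fixed by `K` lies in `f′(σ′)`: the orthogonal projection onto the
closed space of `K`-fixed vectors maps `f′(σ′)` into the finite-dimensional (hence closed) `f′(σ′^K)` (finite averages, `exists_average`), so it maps the closure there.
[cite: BushnellHenniart2006, §2.1–2.2] [cite: BorelJacquet1979, §4.6] -/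
theorem mem_range_of_mem_topologicalClosure (R : ContRepresentation ℂ G V) (hR : R.IsUnitary)
    {W' : Type*} [AddCommGroup W'] [Module ℂ W'] {σ' : Representation ℂ G W'} (hσ'a : σ'.IsAdmissible)
    (f' : σ'.IntertwiningMap R.toRepresentation) (hf' : Function.Injective f')
    (K : OpenSubgroup G) (hKc : IsCompact (K : Set G)) {y : V}
    (hy : y ∈ (LinearMap.range f'.toLinearMap).topologicalClosure) (hfix : ∀ k ∈ (K : Subgroup G), R k y = y) :
    y ∈ LinearMap.range f'.toLinearMap := by
  classical
  set V' : Submodule ℂ V := LinearMap.range f'.toLinearMap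
  set HK : Submodule ℂ V := R.toRepresentation.fixedPoints (K : Subgroup G)
  have hmemHK : ∀ x : V, x ∈ HK ↔ ∀ k ∈ (K : Subgroup G), R k x = x := fun x => R.toRepresentation.mem_fixedPoints _ x
  have hHK_closed : IsClosed (HK : Set V) := by
    have hset : (HK : Set V) = ⋂ k ∈ (K : Subgroup G), {x : V | R k x = x} := by
      ext x; simp only [SetLike.mem_coe, hmemHK, Set.mem_iInter, Set.mem_setOf_eq]
    rw [hset]
    exact isClosed_biInter fun k _ => isClosed_eq (R k).continuous continuous_id
  haveI : CompleteSpace HK := hHK_closed.completeSpace_coe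
  haveI : Module.Finite ℂ (σ'.fixedPoints (K : Subgroup G)) := hσ'a.finite_fixedPoints K hKc
  set D : Submodule ℂ V := (σ'.fixedPoints (K : Subgroup G)).map f'.toLinearMap
  have hD_closed : IsClosed (D : Set V) := D.closed_of_finiteDimensional
  have hDV' : D ≤ V' := LinearMap.map_le_range
  have hmaps : Set.MapsTo HK.starProjection (V' : Set V) (D : Set V) := by
    rintro _ ⟨w', rfl⟩
    have hstab : IsOpen (R.toRepresentation.stabilizerSubgroup (f'.toLinearMap w') : Set G) := by
      refine Subgroup.isOpen_mono ?_ (hσ'a.isSmooth w')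
      intro g hg
      rw [Representation.mem_stabilizerSubgroup] at hg ⊢
      change (R.toRepresentation) g (f' w') = f' w'
      rw [← Representation.IntertwiningMap.isIntertwining _ _ f' g w', hg]
    obtain ⟨a, ha_span, ha_fix, ha_inner⟩ := exists_average R hR hKc hstab
    have hPa : HK.starProjection (f'.toLinearMap w') = a := by
      refine Submodule.eq_starProjection_of_mem_of_inner_eq_zero ((hmemHK a).2 ha_fix) fun u hu => ?_
      rw [inner_eq_zero_symm, inner_sub_right, ha_inner u ((hmemHK u).1 hu), sub_self]
    show HK.starProjection (f'.toLinearMap w') ∈ (D : Set V)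
    rw [hPa]
    have haV' : a ∈ V' := by
      refine (Submodule.span_le.2 ?_) ha_span
      rintro _ ⟨k, rfl⟩
      exact ⟨σ' (k : G) w', Representation.IntertwiningMap.isIntertwining _ _ f' (k : G) w'⟩
    obtain ⟨w'', hw''⟩ := haV'
    refine ⟨w'', (Representation.mem_fixedPoints _ _ _).2 fun k hk => hf' ?_, hw''⟩
    change f' (σ' k w'') = f' w''
    rw [Representation.IntertwiningMap.isIntertwining _ _ f' k w'']
    change R k (f'.toLinearMap w'') = f'.toLinearMap w''
    rw [hw'']
    exact ha_fix k hk
  have hyHK : y ∈ HK := (hmemHK y).2 hfix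
  have hPy : HK.starProjection y = y := Submodule.starProjection_eq_self_iff.2 hyHK
  have hy' : y ∈ closure (V' : Set V) := by rwa [← Submodule.topologicalClosure_coe]
  have hmem : HK.starProjection y ∈ closure (D : Set V) := map_mem_closure HK.starProjection.continuous hy' hmaps
  rw [hD_closed.closure_eq, hPy] at hmem
  exact hDV' hmem

/-! ## §4 Schur across the closure: non-isomorphic smooth ∕ admissible irreducibles embedded in a unitary representation are orthogonal -/

/-- **ORTHOGONALITY OF NON-ISOMORPHIC IRREDUCIBLES INSIDE A UNITARY REPRESENTATION.**  Let `R` be a unitary representation of `G` on a Hilbert space, `G`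
having a compact open subgroup `K₀`; let `σ` be irreducible smooth and `σ′` irreducible admissible, with intertwiners `f : σ → R`, `f′ : σ′ → R`, `f′` injective.
If `σ ≇ σ′` then `f(σ) ⟂ f′(σ′)`: the orthogonal projection onto the closure of `f′(σ′)` commutes with `R`, maps `f(σ)` into `f′(σ′)`
(`mem_range_of_mem_topologicalClosure`), and `f′⁻¹ ∘ Q ∘ f` is an intertwiner `σ → σ′`, hence zero by Schur (Mathlib `Representation.IsIrreducible.bijective_or_eq_zero`).
[cite: BushnellHenniart2006, §2.6] [cite: BernsteinZelevinsky1976, §2.11] [cite: Dixmier1977, §5.4] -/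
theorem inner_eq_zero_of_isEmpty_equiv (R : ContRepresentation ℂ G V) (hR : R.IsUnitary)
    {K₀ : Subgroup G} (hK₀o : IsOpen (K₀ : Set G)) (hK₀c : IsCompact (K₀ : Set G))
    {W W' : Type*} [AddCommGroup W] [Module ℂ W] [AddCommGroup W'] [Module ℂ W']
    {σ : Representation ℂ G W} {σ' : Representation ℂ G W'}
    (hσ : σ.IsIrreducible) (hσs : σ.IsSmooth) (hσ' : σ'.IsIrreducible) (hσ'a : σ'.IsAdmissible)
    (f : σ.IntertwiningMap R.toRepresentation) (f' : σ'.IntertwiningMap R.toRepresentation)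
    (hf' : Function.Injective f') (hne : IsEmpty (σ.Equiv σ')) (w : W) (w' : W') :
    ⟪f' w', f w⟫_ℂ = 0 := by
  classical
  set V' : Submodule ℂ V := LinearMap.range f'.toLinearMap
  set C : Submodule ℂ V := V'.topologicalClosure
  have hC_closed : IsClosed (C : Set V) := V'.isClosed_topologicalClosure
  haveI : CompleteSpace C := hC_closed.completeSpace_coe
  have hV'inv : ∀ g : G, Set.MapsTo (R g) (V' : Set V) (V' : Set V) := by
    rintro g _ ⟨x, rfl⟩
    exact ⟨σ' g x, Representation.IntertwiningMap.isIntertwining _ _ f' g x⟩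
  have hCinv : ∀ (g : G) (x : V), x ∈ C → R g x ∈ C := fun g x hx => by
    have hx' : x ∈ closure (V' : Set V) := by rwa [← Submodule.topologicalClosure_coe]
    have hgx := map_mem_closure (R g).continuous hx' (hV'inv g)
    rwa [← Submodule.topologicalClosure_coe] at hgx
  -- the closure is a closed subrepresentation of the unitary `R`, so its orthogonal complement is invariant as well
  let Cl : ContRepresentation.ClosedSubrep R := ⟨⟨C, fun g x hx => hCinv g x hx⟩, hC_closed⟩
  have hCperp : ∀ (g : G) (x : V), x ∈ Cᗮ → R g x ∈ Cᗮ := fun g x hx =>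
    (Cl.orthogonal hR).apply_mem_toSubmodule g hx
  have hcomm : ∀ (g : G) (x : V), C.starProjection (R g x) = R g (C.starProjection x) := fun g x =>
    Submodule.eq_starProjection_of_mem_orthogonal' (hCinv g _ (C.starProjection_apply_mem x))
      (hCperp g _ (C.sub_starProjection_mem_orthogonal x)) (by rw [← map_add, add_sub_cancel])
  -- `Q (f x)` is fixed by a compact open subgroup, hence lies in `f′(σ′)`
  have hQV' : ∀ x : W, C.starProjection (f x) ∈ V' := fun x => by
    have hSo : IsOpen (σ.stabilizerSubgroup x : Set G) := hσs x
    let K : OpenSubgroup G := ⟨K₀ ⊓ σ.stabilizerSubgroup x, show IsOpen ((K₀ : Set G) ∩ _) from hK₀o.inter hSo⟩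
    have hKc : IsCompact (K : Set G) := by
      change IsCompact ((K₀ ⊓ σ.stabilizerSubgroup x : Subgroup G) : Set G)
      rw [Subgroup.coe_inf]; exact hK₀c.inter_right (Subgroup.isClosed_of_isOpen _ hSo)
    refine mem_range_of_mem_topologicalClosure R hR hσ'a f' hf' K hKc (C.starProjection_apply_mem (f x)) ?_
    intro k hk
    have hk' : σ k x = x := (Subgroup.mem_inf.1 hk).2
    rw [← hcomm]
    congr 1
    change (R.toRepresentation) k (f x) = f x
    rw [← Representation.IntertwiningMap.isIntertwining _ _ f k x, hk']
  -- the intertwiner `T = f′⁻¹ ∘ Q ∘ f : σ → σ′`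
  let e : W' ≃ₗ[ℂ] V' := LinearEquiv.ofInjective f'.toLinearMap hf'
  let g : W →ₗ[ℂ] V' := LinearMap.codRestrict V' ((C.starProjection : V →L[ℂ] V).toLinearMap ∘ₗ f.toLinearMap) hQV'
  let Tl : W →ₗ[ℂ] W' := e.symm.toLinearMap ∘ₗ g
  have hT : ∀ x : W, f' (Tl x) = C.starProjection (f x) := fun x =>
    calc f' (Tl x) = ((e (e.symm (g x)) : V') : V) := (LinearEquiv.ofInjective_apply (h := hf') _ _).symm
      _ = (g x : V) := by rw [LinearEquiv.apply_symm_apply]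
      _ = C.starProjection (f x) := rfl
  let T : σ.IntertwiningMap σ' :=
    { toLinearMap := Tl
      isIntertwining' := fun g₀ => by
        refine LinearMap.ext fun x => ?_
        apply hf'
        change f' (Tl (σ g₀ x)) = f' (σ' g₀ (Tl x))
        rw [hT, Representation.IntertwiningMap.isIntertwining _ _ f' g₀ (Tl x),
          Representation.IntertwiningMap.isIntertwining _ _ f g₀ x]
        change C.starProjection (R g₀ (f x)) = R g₀ (f' (Tl x))
        rw [hT, hcomm] }
  haveI := hσ; haveI := hσ'
  have hT0 : T = 0 :=
    (Representation.IsIrreducible.bijective_or_eq_zero T).elim (fun h => (hne.false (T.ofBijective h)).elim) id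
  have hQ0 : C.starProjection (f w) = 0 := by
    rw [← hT w]
    have hTw : Tl w = 0 := by change T w = 0; rw [hT0]; rfl
    rw [hTw, map_zero]
  have hperp : f w ∈ Cᗮ := (Submodule.starProjection_apply_eq_zero_iff C).1 hQ0
  exact (Submodule.mem_orthogonal C (f w)).1 hperp (f' w') (V'.le_topologicalClosure ⟨w', rfl⟩)

end Unitary

/-! ## §5 The generic frame `F ⊆ E`, `c`, `J`: occurring families are countable -/

section Frame

variable {F E : Type} [Field F] [NumberField F] [Field E] [NumberField E] [Algebra F E] {c : E ≃ₐ[F] E} {N : ℕ}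
  {J : Matrix (Fin N) (Fin N) E}
  {μ : Measure (adelicGroupData F E c N J).automorphicQuotient} [(adelicGroupData F E c N J).IsAutomorphicMeasure μ]

/-- **Two families cut out by ISOMORPHIC finite-adelic representations coincide**: if `σ ≅ σ′` and the constituents of `σ|_{U(J)(F_v)}`, resp. `σ′|_{U(J)(F_v)}`,
are exactly `{π_v}`, resp. `{π′_v}`, at every finite place, then `π = π′` (constituents pass along the equivalence restricted to each place,
★ `IrrClass.IsConstituentOf.of_injective_comp`). [cite: BushnellHenniart2006, §1.1 and §2] -/
theorem family_eq_of_equiv {W W' : Type*} [AddCommGroup W] [Module ℂ W] [AddCommGroup W'] [Module ℂ W']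
    {σ : Representation ℂ (finAdelic F E c N J) W} {σ' : Representation ℂ (finAdelic F E c N J) W'} (e : σ.Equiv σ')
    {π π' : ∀ v : HeightOneSpectrum (𝓞 F), IrrClass (localPi E c N J v)}
    (hπ : ∀ (v : HeightOneSpectrum (𝓞 F)) (c₀ : IrrClass (localPi E c N J v)), c₀.IsConstituentOf (σ.comp (inclPlace F E c N J v)) ↔ c₀ = π v)
    (hπ' : ∀ (v : HeightOneSpectrum (𝓞 F)) (c₀ : IrrClass (localPi E c N J v)), c₀.IsConstituentOf (σ'.comp (inclPlace F E c N J v)) ↔ c₀ = π' v) :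
    π = π' := by
  funext v
  have h1 : (π v).IsConstituentOf (σ.comp (inclPlace F E c N J v)) := (hπ v _).2 rfl
  have h2 : (π v).IsConstituentOf (σ'.comp (inclPlace F E c N J v)) :=
    h1.of_injective_comp (inclPlace F E c N J v) e.toIntertwiningMap e.toLinearEquiv.injective
  exact (hπ' v _).1 h2

/-- **THE OCCURRING FAMILIES OF `U(J)` ARE COUNTABLE (generic frame).**  The set of families `π = (π_v)_v` of local classes occurring in the discrete spectrum of
`L²(U(J)(F)\U(J)(𝔸_F), μ)` (★ `OccursInDiscreteSpectrum`) is countable: distinct occurring families have non-isomorphic irreducible admissible finite components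
(`family_eq_of_equiv`), which embed equivariantly into the finite-adelic restriction of the unitary regular representation, hence give pairwise ORTHOGONAL
non-zero vectors of `L²` (`inner_eq_zero_of_isEmpty_equiv`); and `L²` of the second-countable finite-measure automorphic quotient is separable
(`countable_of_pairwise_inner_eq_zero`). [cite: BorelJacquet1979, §4.6] [cite: Rogawski1990, §13.8 Prop. 13.8.1 p. 213] [cite: Dixmier1977, §5.4] -/
theorem countable_setOf_occursInDiscreteSpectrum :
    {π : ∀ v : HeightOneSpectrum (𝓞 F), IrrClass (localPi E c N J v) | OccursInDiscreteSpectrum μ π}.Countable := by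
  classical
  -- `L²` is separable
  haveI : SecondCountableTopology (GL (Fin N) (AdeleRing (𝓞 E) E)) := secondCountableTopology_generalLinearGroup_adeleRing E (Fin N)
  haveI : SecondCountableTopology (adelicGroupData F E c N J).Adelic := inferInstanceAs (SecondCountableTopology (adelic F E c N J))
  haveI : SecondCountableTopology (adelicGroupData F E c N J).automorphicQuotient :=
    inferInstanceAs (SecondCountableTopology ((adelicGroupData F E c N J).Adelic ⧸ (adelicGroupData F E c N J).quotientSubgroup))
  haveI : Fact ((2 : ENNReal) ≠ ⊤) := ⟨ENNReal.ofNat_ne_top⟩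
  haveI : TopologicalSpace.SeparableSpace ((adelicGroupData F E c N J).L2 μ) := inferInstance
  -- the finite-adelic restriction of the (unitary) regular representation
  let Rf : ContRepresentation ℂ (finAdelic F E c N J) ((adelicGroupData F E c N J).L2 μ) :=
    ContRepresentation.ofMonoidHom (((adelicGroupData F E c N J).rightRegular μ).toMonoidHom.comp (finAdelicToAdelic F E c N J))
  have hRf : Rf.IsUnitary := fun g => (adelicGroupData F E c N J).isUnitary_rightRegular μ (finAdelicToAdelic F E c N J g)
  have hK₀o := isOpen_finAdelicIntegralLevel F E c N J
  have hK₀c := isCompact_finAdelicIntegralLevel F E c N J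
  -- every occurring family carries a non-zero vector of `L²` inside an embedded irreducible admissible `σ` cutting it out
  have hdata : ∀ π : {π : ∀ v : HeightOneSpectrum (𝓞 F), IrrClass (localPi E c N J v) | OccursInDiscreteSpectrum μ π},
      ∃ u : (adelicGroupData F E c N J).L2 μ, u ≠ 0 ∧
        ∃ (W : Type) (_ : AddCommGroup W) (_ : Module ℂ W) (σ : Representation ℂ (finAdelic F E c N J) W)
          (f : σ.IntertwiningMap Rf.toRepresentation), σ.IsIrreducible ∧ σ.IsAdmissible ∧ Function.Injective f ∧
          (∀ (v : HeightOneSpectrum (𝓞 F)) (c₀ : IrrClass (localPi E c N J v)), c₀.IsConstituentOf (σ.comp (inclPlace F E c N J v)) ↔ c₀ = π.1 v) ∧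
          u ∈ LinearMap.range f.toLinearMap := by
    rintro ⟨π, P, W, _, _, σ, hirr, hsm, hadm, ⟨f, hf⟩, hiff⟩
    haveI := hirr
    haveI : Nontrivial W := IrrClass.nontrivial_of_isIrreducible σ
    obtain ⟨w, hw⟩ := exists_ne (0 : W)
    let fE : σ.IntertwiningMap Rf.toRepresentation :=
      { toLinearMap := P.space.toSubmodule.subtype ∘ₗ f.toLinearMap
        isIntertwining' := fun g => by
          refine LinearMap.ext fun x => ?_
          change ((f (σ g x) : P.space.toSubmodule) : (adelicGroupData F E c N J).L2 μ) =
            Rf g ((f x : P.space.toSubmodule) : (adelicGroupData F E c N J).L2 μ)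
          rw [Representation.IntertwiningMap.isIntertwining _ _ f g x]
          rfl }
    have hfE : Function.Injective fE := fun x y h => hf (Subtype.val_injective h)
    refine ⟨fE w, fun h0 => hw (hf ?_), W, _, _, σ, fE, hirr, hadm, hfE, hiff, ⟨w, rfl⟩⟩
    rw [map_zero]
    exact Subtype.val_injective h0
  choose u hu0 hu using hdata
  have horth : Pairwise fun π π' => ⟪u π, u π'⟫_ℂ = 0 := by
    intro π π' hne
    obtain ⟨W, _, _, σ, f, hirr, hadm, hf, hiff, ⟨x, hx⟩⟩ := hu π
    obtain ⟨W', _, _, σ', f', hirr', hadm', hf', hiff', ⟨x', hx'⟩⟩ := hu π'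
    have hne' : IsEmpty (σ'.Equiv σ) :=
      ⟨fun e => hne (Subtype.ext (family_eq_of_equiv e hiff' hiff).symm)⟩
    rw [← hx, ← hx']
    exact inner_eq_zero_of_isEmpty_equiv Rf hRf hK₀o hK₀c hirr' hadm'.isSmooth hirr hadm f' f hf hne' x' x
  exact Set.countable_coe_iff.1 (countable_of_pairwise_inner_eq_zero u hu0 horth)

end Frame

/-! ## §6 The CM currency: `sig_K2E1OccursCountable` token for token -/

/-- **FILE `K2E1OccursCountable` — THE FAMILIES OF LOCAL CLASSES OCCURRING IN THE DISCRETE SPECTRUM OF `U(H)(L⁺)\U(H)(𝔸_{L⁺})` ARE COUNTABLE**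
(`K2E1TraceFormulaBeta.GlobalIndex.sig_K2E1OccursCountable` TOKEN FOR TOKEN; law COUNTABLE of the tier-0 kit).  For ANY `H ∈ M_N(L)` and any automorphic measure
`μ`: distinct occurring families (★ `cmOccursInDiscreteSpectrum`) have non-isomorphic irreducible admissible finite components, which sit in ORTHOGONAL parts of the
separable `L²` (`countable_setOf_occursInDiscreteSpectrum`, transported along ★ `localPiEquiv`, an injection on families by ★ `IrrClass.comap_symm_comap`).
[cite: BorelJacquet1979, §4.6] [cite: Rogawski1990, §13.8 Prop. 13.8.1 p. 213; §13.3 p. 201] [cite: Dixmier1977, §5.4] -/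
theorem OccursCountable :
    ∀ (L : Type) [Field L] [NumberField L] [IsCMField L] (N : ℕ) (H : Matrix (Fin N) (Fin N) L)
      (μ : Measure (adelicGroupData (↥(maximalRealSubfield L)) L (IsCMField.complexConj L) N H).automorphicQuotient)
      [(adelicGroupData (↥(maximalRealSubfield L)) L (IsCMField.complexConj L) N H).IsAutomorphicMeasure μ],
      {π : ∀ u : HeightOneSpectrum (𝓞 ↥(maximalRealSubfield L)), IrrClass ((UnitaryGroup.cmDatum L N H).Local u) |
        cmOccursInDiscreteSpectrum L N H μ π}.Countable := by
  intro L _ _ _ N H μ _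
  have hT : Function.Injective
      (fun (π : ∀ u : HeightOneSpectrum (𝓞 ↥(maximalRealSubfield L)), IrrClass ((UnitaryGroup.cmDatum L N H).Local u))
        (v : HeightOneSpectrum (𝓞 ↥(maximalRealSubfield L))) =>
          IrrClass.comap (localPiEquiv L (IsCMField.complexConj L) N H v) (π v)) := fun π π' h => funext fun v => by
    have hv := congr_arg (IrrClass.comap (localPiEquiv L (IsCMField.complexConj L) N H v).symm) (congr_fun h v)
    rw [IrrClass.comap_symm_comap, IrrClass.comap_symm_comap] at hv
    exact hv
  refine Set.countable_of_injective_of_countable_image hT.injOn ((countable_setOf_occursInDiscreteSpectrum (μ := μ)).mono ?_)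
  rintro _ ⟨π, hπ, rfl⟩
  exact hπ

end Summit.HodgeConjecture.HodgeConjecture.Cruxes.H413.K2E1OccursCountable

end
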